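import Mathlib.LinearAlgebra.Matrix.ToLin
import HarnessLib

/-!
# Products of semi-invariant period vectors, in regular-representation coordinates

`Proofs`-style file (theorems only: no definition, no named fact, no instance).  Pure algebra.

**Setting.**  `K₀` a commutative ring, `E` a commutative `K₀`-algebra with a finite basis
`b = (b_i)_{i ∈ κ}`, `L(e) = leftMulMatrix b e ∈ M_κ(K₀)` the regular representation, `C` a
commutative ring with `ι : K₀ → C` (intended: `K₀ = ℚ_p`, `E/ℚ_p` a finite coefficient field,
`C ∈ {B_dR, ℂ_F, 𝒪̂_{F^nr}}` a period ring).  Coordinates identify `C^κ` with `W = C ⊗_{K₀} E`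
(`x ↦ Σ x_i ⊗ b_i`); multiplication by `1 ⊗ e` is the matrix `L(e)` (mapped by `ι`), and
multiplication by `x ∈ W` is the **multiplication matrix** `P_x = Σ_i x_i · ι(L(b_i))`.  A vector
`x` is *semi-invariant* for `e ∈ E` under a ring endomorphism `φ` of `C` fixing `ι(K₀)` (a Galois
automorphism) when `φ(x) = ι(L(e)) x`, i.e. `φ(x) = (1 ⊗ e) x` in `W`.

**What is printed.**  Fontaine–Ouyang, *Theory of p-adic Galois representations*, Thm. 2.13 (2):
for a `(K₀, G)`-regular ring `B` the functor `D_B(V) = (B ⊗ V)^G` is compatible with tensor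
products on `B`-admissible objects, `D_B(V₁) ⊗ D_B(V₂) ⥲ D_B(V₁ ⊗ V₂)` — for rank-one `E`-linear
objects: the product (in `B ⊗ E`) of a period of the character `η₁` and a period of `η₂` is a
period of `η₁ η₂`.

**What is proved here** — that statement in coordinates, for arbitrary vectors:
* `mulMatrix_mulVec_smul_eq` — `P_{ι(L(e)) x} = ι(L(e)) · P_x` (`E`-linearity of `x ↦ P_x`);
* `mulMatrix_mulVec_mulVec` — **twisted multiplicativity**:
  `P_{ι(L(e₁)) x} (ι(L(e₂)) y) = ι(L(e₁ e₂)) (P_x y)`;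
* `comp_mulMatrix_mulVec` — a ring endomorphism `φ` fixing `ι(K₀)` satisfies
  `φ(P_x y) = P_{φ x} (φ y)`; hence (`comp_mulMatrix_mulVec_of_semiInvariant`) **if `x` is
  semi-invariant for `e₁` and `y` for `e₂` then `P_x y` is semi-invariant for `e₁ e₂`**;
* `mulMatrix_mulVec_repr_one` — `P_x · ι(coords of 1_E) = x` (unit law), and
  `exists_mulMatrix_mulVec_col_ne_zero` — **if `x ≠ 0` and `Y ∈ GL_κ(C)` then `P_x (Y e_i) ≠ 0`
  for some column `Y e_i` of `Y`** (the columns span `C^κ ∋` coords of `1`).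

## References

* J.-M. Fontaine, Y. Ouyang, *Theory of p-adic Galois representations* (2022 draft), Thm. 2.13.
  [`FontaineOuyang2022`]
* J.-M. Fontaine, *Représentations p-adiques semi-stables*, Astérisque 223 (1994), Exp. III §1.5.
  [`FontaineAsterisque223III`]
-/

namespace Literature.NumberTheory.PAdicHodge

namespace SemiInvariant

open Matrix

variable {K₀ : Type*} [CommRing K₀] {E : Type*} [CommRing E] [Algebra K₀ E]
  {κ : Type*} [Fintype κ] [DecidableEq κ] (b : Module.Basis κ K₀ E)
  {C : Type*} [CommRing C] (ι : K₀ →+* C)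

/-! ### The regular representation -/

/-- `Σ_i L(e)_{ia} L(b_i) = L(e b_a)` (`e b_a = Σ_i L(e)_{ia} b_i` and `L` is `K₀`-linear). [folklore] -/
private theorem sum_leftMulMatrix_apply_smul (e : E) (a : κ) :
    ∑ i, Algebra.leftMulMatrix b e i a • Algebra.leftMulMatrix b (b i) =
      Algebra.leftMulMatrix b (e * b a) := by
  have h : e * b a = ∑ i, Algebra.leftMulMatrix b e i a • b i := by
    simp_rw [Algebra.leftMulMatrix_eq_repr_mul]
    exact (b.sum_repr (e * b a)).symm
  rw [h, map_sum]
  simp_rw [map_smul]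

/-- The same identity after `ι`: `Σ_i ι(L(e)_{ia}) ι(L(b_i)) = ι(L(e b_a))`. [folklore] -/
private theorem sum_leftMulMatrix_apply_smul_map (e : E) (a : κ) :
    ∑ i, ι (Algebra.leftMulMatrix b e i a) • (Algebra.leftMulMatrix b (b i)).map ι =
      (Algebra.leftMulMatrix b (e * b a)).map ι := by
  rw [← sum_leftMulMatrix_apply_smul b e a]
  ext k j
  simp only [Matrix.sum_apply, Matrix.smul_apply, Matrix.map_apply, smul_eq_mul, map_sum, map_mul]

/-- `ι(L(e₁ e₂)) = ι(L(e₁)) ι(L(e₂))`. [folklore] -/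
private theorem leftMulMatrix_map_mul (e₁ e₂ : E) :
    (Algebra.leftMulMatrix b (e₁ * e₂)).map ι =
      (Algebra.leftMulMatrix b e₁).map ι * (Algebra.leftMulMatrix b e₂).map ι := by
  rw [map_mul, Matrix.map_mul]

/-- The matrices `ι(L(e))` commute with every multiplication matrix `P_x` (`E` is commutative).
[folklore] -/
private theorem mulMatrix_mul_leftMulMatrix_map (x : κ → C) (e : E) :
    (∑ i, x i • (Algebra.leftMulMatrix b (b i)).map ι) * (Algebra.leftMulMatrix b e).map ι =
      (Algebra.leftMulMatrix b e).map ι * ∑ i, x i • (Algebra.leftMulMatrix b (b i)).map ι := by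
  rw [Finset.sum_mul, Finset.mul_sum]
  refine Finset.sum_congr rfl fun i _ => ?_
  rw [Matrix.smul_mul, Matrix.mul_smul, ← leftMulMatrix_map_mul, ← leftMulMatrix_map_mul, mul_comm]

/-! ### The multiplication matrix is `E`-linear; twisted multiplicativity -/

/-- **`P_{ι(L(e)) x} = ι(L(e)) P_x`**: the multiplication matrix of `(1 ⊗ e) x` is `ι(L(e))` times
that of `x`. [cite: FontaineOuyang2022, Thm. 2.13] -/
theorem mulMatrix_mulVec_smul_eq (e : E) (x : κ → C) :
    ∑ i, ((Algebra.leftMulMatrix b e).map ι *ᵥ x) i • (Algebra.leftMulMatrix b (b i)).map ι =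
      (Algebra.leftMulMatrix b e).map ι * ∑ a, x a • (Algebra.leftMulMatrix b (b a)).map ι := by
  calc ∑ i, ((Algebra.leftMulMatrix b e).map ι *ᵥ x) i • (Algebra.leftMulMatrix b (b i)).map ι
      = ∑ i, ∑ a, x a • (ι (Algebra.leftMulMatrix b e i a) • (Algebra.leftMulMatrix b (b i)).map ι) := by
        refine Finset.sum_congr rfl fun i _ => ?_
        rw [Matrix.mulVec, dotProduct, Finset.sum_smul]
        refine Finset.sum_congr rfl fun a _ => ?_
        rw [Matrix.map_apply, smul_smul, mul_comm]
    _ = ∑ a, x a • (Algebra.leftMulMatrix b (e * b a)).map ι := by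
        rw [Finset.sum_comm]
        refine Finset.sum_congr rfl fun a _ => ?_
        rw [← Finset.smul_sum, sum_leftMulMatrix_apply_smul_map]
    _ = (Algebra.leftMulMatrix b e).map ι * ∑ a, x a • (Algebra.leftMulMatrix b (b a)).map ι := by
        rw [Finset.mul_sum]
        refine Finset.sum_congr rfl fun a _ => ?_
        rw [leftMulMatrix_map_mul, Matrix.mul_smul]

/-- **Twisted multiplicativity**: `P_{ι(L(e₁)) x} (ι(L(e₂)) y) = ι(L(e₁ e₂)) (P_x y)` — in
`W = C ⊗ E`, `((1 ⊗ e₁) x) · ((1 ⊗ e₂) y) = (1 ⊗ e₁ e₂) (x y)`. [cite: FontaineOuyang2022, Thm. 2.13] -/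
theorem mulMatrix_mulVec_mulVec (e₁ e₂ : E) (x y : κ → C) :
    (∑ i, ((Algebra.leftMulMatrix b e₁).map ι *ᵥ x) i • (Algebra.leftMulMatrix b (b i)).map ι) *ᵥ
        ((Algebra.leftMulMatrix b e₂).map ι *ᵥ y) =
      (Algebra.leftMulMatrix b (e₁ * e₂)).map ι *ᵥ
        ((∑ i, x i • (Algebra.leftMulMatrix b (b i)).map ι) *ᵥ y) := by
  rw [mulMatrix_mulVec_smul_eq, Matrix.mulVec_mulVec, Matrix.mulVec_mulVec, mul_assoc,
    mulMatrix_mul_leftMulMatrix_map, ← mul_assoc, ← leftMulMatrix_map_mul]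

/-! ### Compatibility with a ring endomorphism fixing the scalars -/

/-- A ring endomorphism `φ` of `C` fixing `ι(K₀)` satisfies **`φ(P_x y) = P_{φ x} (φ y)`**: the
diagonal action of `φ` on `W = C ⊗ E` is by ring endomorphisms (`B ⊗ E` is a ring with `G`-action
through the first factor). [cite: FontaineAsterisque223III, Exp. III §1.5]
[cite: FontaineOuyang2022, Thm. 2.13] -/
theorem comp_mulMatrix_mulVec (φ : C →+* C) (hφ : ∀ a, φ (ι a) = ι a) (x y : κ → C) :
    φ ∘ ((∑ i, x i • (Algebra.leftMulMatrix b (b i)).map ι) *ᵥ y) =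
      (∑ i, (φ ∘ x) i • (Algebra.leftMulMatrix b (b i)).map ι) *ᵥ (φ ∘ y) := by
  have hmap : (∑ i, x i • (Algebra.leftMulMatrix b (b i)).map ι).map φ =
      ∑ i, (φ ∘ x) i • (Algebra.leftMulMatrix b (b i)).map ι := by
    ext k j
    simp only [Matrix.map_apply, Matrix.sum_apply, Matrix.smul_apply, smul_eq_mul, map_sum, map_mul,
      hφ, Function.comp_apply]
  funext k
  rw [Function.comp_apply, RingHom.map_mulVec, hmap]

/-- `φ(ι(L(e)) v) = ι(L(e)) φ(v)`. [folklore] -/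
private theorem comp_leftMulMatrix_map_mulVec (φ : C →+* C) (hφ : ∀ a, φ (ι a) = ι a) (e : E)
    (v : κ → C) :
    φ ∘ ((Algebra.leftMulMatrix b e).map ι *ᵥ v) = (Algebra.leftMulMatrix b e).map ι *ᵥ (φ ∘ v) := by
  have hmap : ((Algebra.leftMulMatrix b e).map ι).map φ = (Algebra.leftMulMatrix b e).map ι := by
    rw [Matrix.map_map]
    exact congrArg _ (funext hφ)
  funext k
  rw [Function.comp_apply, RingHom.map_mulVec, hmap]

/-- **Products of semi-invariant vectors are semi-invariant for the product character**: if
`φ(x) = ι(L(e₁)) x` and `φ(y) = ι(L(e₂)) y` for a ring endomorphism `φ` fixing `ι(K₀)`, then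
`z = P_x y` satisfies `φ(z) = ι(L(e₁ e₂)) z`.  (Coordinate form of
`D_B(η₁) ⊗ D_B(η₂) → D_B(η₁ η₂)`.) [cite: FontaineOuyang2022, Thm. 2.13]
[cite: FontaineAsterisque223III, Exp. III §1.5] -/
theorem comp_mulMatrix_mulVec_of_semiInvariant (φ : C →+* C) (hφ : ∀ a, φ (ι a) = ι a)
    {e₁ e₂ : E} {x y : κ → C}
    (hx : φ ∘ x = (Algebra.leftMulMatrix b e₁).map ι *ᵥ x)
    (hy : φ ∘ y = (Algebra.leftMulMatrix b e₂).map ι *ᵥ y) :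
    φ ∘ ((∑ i, x i • (Algebra.leftMulMatrix b (b i)).map ι) *ᵥ y) =
      (Algebra.leftMulMatrix b (e₁ * e₂)).map ι *ᵥ
        ((∑ i, x i • (Algebra.leftMulMatrix b (b i)).map ι) *ᵥ y) := by
  rw [comp_mulMatrix_mulVec b ι φ hφ, hx, hy, mulMatrix_mulVec_mulVec]

/-- Iterating: `φ(ι(L(e)) v) = ι(L(e)) φ v`, so a vector of the form `ι(L(e)) x` with `x`
semi-invariant for `e'` is semi-invariant for `e'` as well (the matrices `ι(L(·))` commute: the
`E`-structure of `W = C ⊗ E` commutes with the action). [cite: FontaineAsterisque223III, Exp. III §1.5]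
[cite: FontaineOuyang2022, Thm. 2.13] -/
theorem comp_leftMulMatrix_map_mulVec_of_semiInvariant (φ : C →+* C) (hφ : ∀ a, φ (ι a) = ι a)
    (e : E) {e' : E} {x : κ → C} (hx : φ ∘ x = (Algebra.leftMulMatrix b e').map ι *ᵥ x) :
    φ ∘ ((Algebra.leftMulMatrix b e).map ι *ᵥ x) =
      (Algebra.leftMulMatrix b e').map ι *ᵥ ((Algebra.leftMulMatrix b e).map ι *ᵥ x) := by
  rw [comp_leftMulMatrix_map_mulVec b ι φ hφ, hx, Matrix.mulVec_mulVec, Matrix.mulVec_mulVec,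
    ← leftMulMatrix_map_mul, ← leftMulMatrix_map_mul, mul_comm]

/-! ### Unit law and non-vanishing -/

/-- **Unit law**: `P_x · ι(coords of 1_E) = x` (`x · 1 = x` in the ring `W = C ⊗ E`).
[cite: FontaineAsterisque223III, Exp. III §1.5] [cite: FontaineOuyang2022, Thm. 2.13] -/
theorem mulMatrix_mulVec_repr_one (x : κ → C) :
    (∑ i, x i • (Algebra.leftMulMatrix b (b i)).map ι) *ᵥ (ι ∘ ⇑(b.repr 1)) = x := by
  have hcol : ∀ i, (Algebra.leftMulMatrix b (b i)).map ι *ᵥ (ι ∘ ⇑(b.repr 1)) = ι ∘ ⇑(b.repr (b i)) := by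
    intro i
    funext k
    rw [← RingHom.map_mulVec, Algebra.leftMulMatrix_mulVec_repr, mul_one, Function.comp_apply]
  funext k
  rw [Matrix.sum_mulVec, Finset.sum_apply]
  simp_rw [Matrix.smul_mulVec, hcol, Pi.smul_apply, Function.comp_apply, b.repr_self,
    Finsupp.single_apply, smul_eq_mul]
  simp_rw [apply_ite ι, map_one, map_zero, mul_ite, mul_one, mul_zero]
  rw [Finset.sum_ite_eq' Finset.univ k]
  simp

/-- **Non-vanishing of some product**: if `x ≠ 0` and `Y ∈ GL_κ(C)`, then `P_x (Y e_i) ≠ 0` for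
some column `Y e_i` of `Y` (otherwise `P_x Y = 0`, so `P_x = 0` and `x = P_x · 1 = 0`).  Used with
`Y` a matrix of unit periods of an unramified character, whose columns are semi-invariant.
[cite: FontaineOuyang2022, Thm. 2.13] -/
theorem exists_mulMatrix_mulVec_col_ne_zero {x : κ → C} (hx : x ≠ 0) {Y : Matrix κ κ C}
    (hY : IsUnit Y) :
    ∃ i, (∑ a, x a • (Algebra.leftMulMatrix b (b a)).map ι) *ᵥ (fun k => Y k i) ≠ 0 := by
  by_contra h
  push Not at h
  set P := ∑ a, x a • (Algebra.leftMulMatrix b (b a)).map ι with hP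
  have hPY : P * Y = 0 := by
    ext k i
    have := congrFun (h i) k
    simpa [Matrix.mul_apply, Matrix.mulVec, dotProduct] using this
  obtain ⟨U, rfl⟩ := hY
  have hP0 : P = 0 := by
    rw [← Units.mul_inv_cancel_right P U, hPY, zero_mul]
  apply hx
  rw [← mulMatrix_mulVec_repr_one b ι x, ← hP, hP0, Matrix.zero_mulVec]

end SemiInvariant

end Literature.NumberTheory.PAdicHodge
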